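import Summits.QuantumAdvantage.QuantumAdvantage.Theorems.SymplecticPurityDeqThesisOneSidedFlat

/-!
# Crux `DeqThesis` (stmt-QuantumAdvantage-0242), line `Sketch` — stub `stub_unbalancedFlat`

The cycle-2 reshape of the open core (`Cruxes/DeqThesis/Lines/Sketch.lean`, stub K4b). The one-sided
pairing estimate `OneSided.norm_double_sum_le` (file `SymplecticPurityDeqThesisOneSidedLemmas.lean`)
bounds the off-diagonal part of `2ⁿ⟨ĝ|O|ĝ⟩` by `2 (Σ_d w_A(d)) (Σ_t w_B(t))`, and for product weights
`Σ_d w(d) = ∏ₖ (|Mₖ(0,0)| + |Mₖ(0,1)|)` (`OneSided.sum_weight_eq_prod`). Keeping these products instead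
of bounding them by support sizes gives

  `|⟨ĝ| ⊗ₖ uₖσ_{Sₖ}uₖ† |ĝ⟩| ≤ 2^{-n} (2 √2ⁿ + 2 ∏_{k<2n} (|Mₖ(0,0)| + |Mₖ(0,1)|))`

(`norm_graph_dot_le_prod`), so the expectation is `≤ 2^{-n/16}` as soon as the tilt product
`∏ₖ (|cₖ| + sₖ)` is `≤ 2^{7n/8}` and `n ≥ 32` (`stub_unbalancedFlat`): flatness fails to follow only
for DOUBLY-BALANCED tests (nearly all `2n` sites tilted to ≈ 45°), which is the reshaped core
`stub_coreBalancedFlat`.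
-/

set_option linter.dupNamespace false -- D-0017: single-problem summit ⇒ `QuantumAdvantage.QuantumAdvantage` by design

namespace Summit.QuantumAdvantage.QuantumAdvantage.Theorems.SymplecticPurity

open Matrix Finset Literature.Computability.QuantumComplexity Literature.Computability.Cryptography

namespace OneSided

/-- **Main estimate, product form.** For the weighted cube graph vector `g = c Σ_x |x⟩|F x⟩` and a
locally rotated Pauli string `O = ⊗ₖ Mₖ`, `Mₖ = uₖ σ_{Sₖ} uₖ†`, `S ≠ I`:
`|⟨g| O |g⟩| ≤ |c|² (2 √2ⁿ + 2 ∏_{i<n} (|Mᵢ(0,0)| + |Mᵢ(0,1)|) ∏_{j<n} (|M_{n+j}(0,0)| + |M_{n+j}(0,1)|))`. -/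
theorem norm_graph_dot_le_prod {n : ℕ} {K : Type*} [Field K] [Fintype K] (hK : Fintype.card K = 2 ^ n)
    (e : K ≃+ (Fin n → ZMod 2)) (u : Fin (n + n) → Matrix Bool Bool ℂ)
    (hu : ∀ i, u i ∈ Matrix.unitaryGroup Bool ℂ) (S : Fin (n + n) → Pauli)
    (hS : S ≠ fun _ => Pauli.I) (F : QReg n → QReg n)
    (hF : ∀ x j, F x j = decide (e ((e.symm fun i : Fin n => if x i then 1 else 0) ^ 3) j = 1))
    (c : ℂ) :
    ‖star (fun w : QReg (n + n) =>
        if (fun j : Fin n => w (Fin.natAdd n j)) = F (fun i : Fin n => w (Fin.castAdd n i))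
        then c else 0) ⬝ᵥ
      (tensorAll (fun i => u i * (S i).mat * star (u i))).mulVec (fun w : QReg (n + n) =>
        if (fun j : Fin n => w (Fin.natAdd n j)) = F (fun i : Fin n => w (Fin.castAdd n i))
        then c else 0)‖ ≤
    ‖c‖ ^ 2 * (2 * Real.sqrt 2 ^ n +
      2 * (∏ i : Fin n, (‖(u (Fin.castAdd n i) * (S (Fin.castAdd n i)).mat * star (u (Fin.castAdd n i))) false false‖ +
          ‖(u (Fin.castAdd n i) * (S (Fin.castAdd n i)).mat * star (u (Fin.castAdd n i))) false true‖)) *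
        ∏ j : Fin n, (‖(u (Fin.natAdd n j) * (S (Fin.natAdd n j)).mat * star (u (Fin.natAdd n j))) false false‖ +
          ‖(u (Fin.natAdd n j) * (S (Fin.natAdd n j)).mat * star (u (Fin.natAdd n j))) false true‖)) := by
  classical
  obtain ⟨M, hM⟩ : ∃ M : Fin (n + n) → Matrix Bool Bool ℂ, M = fun k => u k * (S k).mat * star (u k) :=
    ⟨_, rfl⟩
  rw [show (fun i => u i * (S i).mat * star (u i)) = M from hM.symm]
  simp_rw [show ∀ k, u k * (S k).mat * star (u k) = M k from fun k => by rw [hM]]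
  have hMu : ∀ k, M k ∈ Matrix.unitaryGroup Bool ℂ := fun k => by
    rw [hM]
    exact conj_mem_unitaryGroup (hu k) (S k)
  have hMd : ∀ k b, M k b b = M k false false *
      ((if (if S k = Pauli.I then (0 : ZMod 2) else 1) * (if b then (1 : ZMod 2) else 0) = 0
        then (1 : ℝ) else -1 : ℝ) : ℂ) := fun k b => by
    rw [hM]
    exact conj_apply_diag (hu k) (S k) b
  -- masks of the two registers are not both zero
  have h10 : (1 : ZMod 2) ≠ 0 := by decide
  have hm : (fun i : Fin n => (fun k => if S k = Pauli.I then (0 : ZMod 2) else 1) (Fin.castAdd n i)) ≠ 0 ∨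
      (fun j : Fin n => (fun k => if S k = Pauli.I then (0 : ZMod 2) else 1) (Fin.natAdd n j)) ≠ 0 := by
    obtain ⟨k, hk⟩ := Function.ne_iff.1 hS
    revert hk
    refine Fin.addCases
      (motive := fun k => S k ≠ Pauli.I →
        ((fun i : Fin n => (fun k => if S k = Pauli.I then (0 : ZMod 2) else 1) (Fin.castAdd n i)) ≠ 0 ∨
        (fun j : Fin n => (fun k => if S k = Pauli.I then (0 : ZMod 2) else 1) (Fin.natAdd n j)) ≠ 0))
      (fun i hi => Or.inl fun h0 => ?_) (fun j hj => Or.inr fun h0 => ?_) k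
    · have h1 := congrFun h0 i
      simp only [Pi.zero_apply, hi, if_false] at h1
      exact h10 h1
    · have h1 := congrFun h0 j
      simp only [Pi.zero_apply, hj, if_false] at h1
      exact h10 h1
  -- total masses of the product weights (kept as products)
  have hWA : ∑ d : QReg n, ∏ i : Fin n,
      (if d i then ‖M (Fin.castAdd n i) false true‖ else ‖M (Fin.castAdd n i) false false‖) =
      ∏ i : Fin n, (‖M (Fin.castAdd n i) false false‖ + ‖M (Fin.castAdd n i) false true‖) :=
    sum_weight_eq_prod (fun i => ‖M (Fin.castAdd n i) false false‖)
      (fun i => ‖M (Fin.castAdd n i) false true‖)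
  have hWB : ∑ t : QReg n, ∏ j : Fin n,
      (if t j then ‖M (Fin.natAdd n j) false true‖ else ‖M (Fin.natAdd n j) false false‖) ≤
      ∏ j : Fin n, (‖M (Fin.natAdd n j) false false‖ + ‖M (Fin.natAdd n j) false true‖) :=
    (sum_weight_eq_prod (fun j => ‖M (Fin.natAdd n j) false false‖)
      (fun j => ‖M (Fin.natAdd n j) false true‖)).le
  -- the expansion and the pairing estimate
  rw [graph_dot_tensorAll_mulVec F M c _ rfl, norm_mul, norm_mul, norm_star, ← sq]
  refine mul_le_mul_of_nonneg_left ?_ (sq_nonneg _)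
  refine (norm_double_sum_le
    (fun x x' => ∏ i : Fin n, M (Fin.castAdd n i) (x i) (x' i))
    (fun y y' => ∏ j : Fin n, M (Fin.natAdd n j) (y j) (y' j)) F
    (fun d => ∏ i : Fin n,
      (if d i then ‖M (Fin.castAdd n i) false true‖ else ‖M (Fin.castAdd n i) false false‖))
    (fun t => ∏ j : Fin n,
      (if t j then ‖M (Fin.natAdd n j) false true‖ else ‖M (Fin.natAdd n j) false false‖))
    (2 * Real.sqrt 2 ^ n)
    (∏ j : Fin n, (‖M (Fin.natAdd n j) false false‖ + ‖M (Fin.natAdd n j) false true‖))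
    (fun x x' => (norm_prod_entry (fun i => M (Fin.castAdd n i)) (fun i => hMu _) x x').le)
    (fun y y' => (norm_prod_entry (fun j => M (Fin.natAdd n j)) (fun j => hMu _) y y').le)
    (fun d => Finset.prod_nonneg fun i _ => by positivity)
    (fun t => Finset.prod_nonneg fun j _ => by positivity)
    (norm_diag_sum_le hK e (fun k => if S k = Pauli.I then (0 : ZMod 2) else 1) hm M
      (fun k => M k false false) (fun k => entry_norm_bound_of_unitary (hMu k) _ _) hMd F hF)
    (card_filter_cube_xor_le_two hK e F hF) hWB).trans ?_
  rw [hWA]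

/-- **Final arithmetic, product form**: `2^{-n} (2 √2ⁿ + 2 P) ≤ 2^{-n/16}` for `n ≥ 32` and
`P ≤ 2^{7n/8}`. -/
theorem final_bound_prod (n : ℕ) (hn : 32 ≤ n) (P : ℝ) (hP : P ≤ (2 : ℝ) ^ ((7 : ℝ) / 8 * n)) :
    ‖((Real.sqrt 2 : ℂ) ^ n)⁻¹‖ ^ 2 * (2 * Real.sqrt 2 ^ n + 2 * P) ≤
      (2 : ℝ) ^ (-(1 / 16 * (n : ℝ))) := by
  have h2 : (0 : ℝ) < 2 := by norm_num
  have hn' : (32 : ℝ) ≤ n := by exact_mod_cast hn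
  have hsq : Real.sqrt 2 ^ n = (2 : ℝ) ^ ((n : ℝ) / 2) := by
    rw [Real.sqrt_eq_rpow, ← Real.rpow_natCast, ← Real.rpow_mul h2.le]
    congr 1
    ring
  have hnorm : ‖((Real.sqrt 2 : ℂ) ^ n)⁻¹‖ ^ 2 = (2 : ℝ) ^ (-(n : ℝ)) := by
    rw [norm_inv, norm_pow, Complex.norm_real, Real.norm_of_nonneg (Real.sqrt_nonneg _), inv_pow,
      ← pow_mul, pow_mul', Real.sq_sqrt h2.le, Real.rpow_neg h2.le, Real.rpow_natCast]
  have hP' : (2 : ℝ) ^ (-(n : ℝ)) * P ≤ (2 : ℝ) ^ (-(n : ℝ) / 8) := by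
    calc (2 : ℝ) ^ (-(n : ℝ)) * P ≤ (2 : ℝ) ^ (-(n : ℝ)) * (2 : ℝ) ^ ((7 : ℝ) / 8 * n) := by gcongr
      _ = (2 : ℝ) ^ (-(n : ℝ) / 8) := by
          rw [← Real.rpow_add h2]
          congr 1
          ring
  rw [hnorm, hsq]
  calc (2 : ℝ) ^ (-(n : ℝ)) * (2 * 2 ^ ((n : ℝ) / 2) + 2 * P)
      = 2 * 2 ^ (-(n : ℝ) + n / 2) + 2 * (2 ^ (-(n : ℝ)) * P) := by
        rw [Real.rpow_add h2]
        ring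
    _ ≤ 2 * 2 ^ (-(n : ℝ) / 8) + 2 * 2 ^ (-(n : ℝ) / 8) := by
        have e1 : (2 : ℝ) ^ (-(n : ℝ) + n / 2) ≤ 2 ^ (-(n : ℝ) / 8) :=
          Real.rpow_le_rpow_of_exponent_le one_le_two (by linarith)
        linarith
    _ = 2 ^ ((2 : ℝ) + -(n : ℝ) / 8) := by
        rw [Real.rpow_add h2, Real.rpow_two]
        ring
    _ ≤ 2 ^ (-(1 / 16 * (n : ℝ))) := Real.rpow_le_rpow_of_exponent_le one_le_two (by linarith)

end OneSided

/-- **Stub K4b · `stub_unbalancedFlat`** of line `Sketch` (registered on stmt-QuantumAdvantage-0242):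
flatness of the normalised cube graph state against every locally rotated Pauli string whose tilt
product `∏_{k<2n} (|M_k(0,0)| + |M_k(0,1)|)` is at most `2^{7n/8}` — i.e. unless nearly all `2n` sites
are tilted to ≈ 45° — for arbitrary complex rotations, any field of order `2ⁿ`, any additive `e`;
`δ = 1/16`, `n₀ = 32`. -/
theorem stub_unbalancedFlat :
    ∃ δ : ℝ, 0 < δ ∧ ∃ n₀ : ℕ, ∀ n ≥ n₀, ∀ (K : Type) [Field K] [Fintype K], Fintype.card K = 2 ^ n →
      ∀ e : K ≃+ (Fin n → ZMod 2),
      ∀ u : Fin (n + n) → Matrix Bool Bool ℂ, (∀ i, u i ∈ Matrix.unitaryGroup Bool ℂ) →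
        ∀ S : Fin (n + n) → Pauli, S ≠ (fun _ => Pauli.I) →
          (∏ k : Fin (n + n), (‖(u k * (S k).mat * star (u k)) false false‖ +
              ‖(u k * (S k).mat * star (u k)) false true‖) ≤ (2 : ℝ) ^ ((7 : ℝ) / 8 * n)) →
          ‖star (fun w : QReg (n + n) =>
                if (fun j : Fin n => w (Fin.natAdd n j)) =
                    (fun j : Fin n => decide (e ((e.symm (fun i : Fin n => if w (Fin.castAdd n i) then 1 else 0)) ^ 3) j = 1))
                then ((Real.sqrt 2 ^ n)⁻¹ : ℂ) else 0) ⬝ᵥ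
              (tensorAll (fun i => u i * (S i).mat * star (u i))).mulVec
                (fun w : QReg (n + n) =>
                  if (fun j : Fin n => w (Fin.natAdd n j)) =
                      (fun j : Fin n => decide (e ((e.symm (fun i : Fin n => if w (Fin.castAdd n i) then 1 else 0)) ^ 3) j = 1))
                  then ((Real.sqrt 2 ^ n)⁻¹ : ℂ) else 0)‖
            ≤ (2 : ℝ) ^ (-(δ * (n : ℝ))) := by
  refine ⟨1 / 16, by norm_num, 32, ?_⟩
  intro n hn K _ _ hK e u hu S hS hprod
  refine le_trans (OneSided.norm_graph_dot_le_prod hK e u hu S hS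
    (fun x j => decide (e ((e.symm fun i : Fin n => if x i then 1 else 0) ^ 3) j = 1))
    (fun x j => rfl) _) ?_
  have hsplit := Fin.prod_univ_add (fun k : Fin (n + n) =>
    ‖(u k * (S k).mat * star (u k)) false false‖ + ‖(u k * (S k).mat * star (u k)) false true‖)
  rw [hsplit] at hprod
  rw [mul_assoc (2 : ℝ)]
  exact OneSided.final_bound_prod n hn _ hprod

end Summit.QuantumAdvantage.QuantumAdvantage.Theorems.SymplecticPurity
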